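import Summits.HubbardSuperconductivity.HubbardSuperconductivity.Theorems.AnisotropyChordTransferGapMonotone

/-!
# Route `AnisotropyChord` / H0 rotor rung, route (1): the ferromagnetic point `Δ = 1` —
# REDUCTION OF THE NAMED HYPOTHESIS `FerroSectorGapCLR` TO THE EXCLUSION-PROCESS POINCARÉ INEQUALITY

`FerroSectorGapCLR` (`…Transfer.FerroSectorGapCLR`, PART N19) is the one spectral input of the theory seat's
near-END / GM₂ theorems that is a THEOREM in print but was typed as a HYPOTHESIS: at `Δ = 1` the sector
Hamiltonian `H(1) = −Σ_b [½(S⁺S⁻ + h.c.) + SᶻSᶻ]` of the `L × L` torus is, up to the constant `−D/8`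
(`D = Σ_x Σ_y [x ∼ y]`), the generator `A = ½ Σ_{edges} (1 − T_xy)` of the symmetric exclusion process
(tree: `fmOp`, `inner_fmOp_eq`), whose gap in every particle-number sector is the one-particle gap
`1 − cos(2π/L)` (Aldous' spectral-gap conjecture = Caputo–Liggett–Richthammer 2010, Thm 1.1).

This file proves the DICTIONARY half, for every `L`, every sector `M` and every constant `t`:

* `perron_inner_fmOp_eq_zero_of_one` — a Perron sector ground amplitude `a` of `H(1)` has `⟨a, A a⟩ = 0` and
  sector energy `E(M) = −D/8` (variational comparison with the uniform sector amplitude, `rayleigh_real`,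
  against `⟨a, A a⟩ ≥ 0`, `inner_fmOp_nonneg`);
* `perron_const_of_one` — hence `a` is constant on every particle-number sector (kernel of the transposition
  form on the connected torus: `swapInvariant_of_inner_fmOp_eq_zero`, `sectorFun_of_edgeSwapInvariant`);
* `sectorGapAtLeast_one_of_exclusionGap` — **if** every real amplitude `ψ` supported on the sector
  `Sᶻ_tot = M` with `Σ_σ ψ σ = 0` satisfies the exclusion Poincaré inequality `t · Σ ψ² ≤ ⟨ψ, A ψ⟩`, **then**
  `SectorGapAtLeast L 1 M t` (Temple form: `t (1 − ⟨a, φ⟩²) ≤ ⟨φ, H(1) φ⟩ − E(M)` for unit real `φ` in the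
  sector; `ψ = φ − ⟨a, φ⟩ a`).

The hypothesis is discharged (with `t = 1 − cos(2π/L)`, `L ≥ 3`) from the tree's Caputo–Liggett–Richthammer
theorem `Literature.RepresentationTheory.FiniteGroups.clr_spectralGap` in the companion files
`AnisotropyChordTransferTorusPoincare` (one-particle gap of the torus) and `AnisotropyChordTransferExclusionGap`
(exclusion ≥ interchange ≥ random walk).  Prover seat `hubbard-h0-rotor-p1` g20; helper for the S-bridge dossier of
stmt-HubbardSuperconductivity-19089.  No definition is introduced; nothing here is a statement about the Hubbard model.

References: P. Caputo, T. M. Liggett, T. Richthammer, J. Amer. Math. Soc. 23 (2010) 831–851, Thm 1.1;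
T. M. Liggett, *Interacting Particle Systems* (1985), Ch. VIII (exclusion ↔ stirring).
-/

set_option linter.dupNamespace false
set_option autoImplicit false

noncomputable section

open Finset
open Literature.MathematicalPhysics.QuantumLattice Literature.Probability.LatticeModels
open Summit.HubbardSuperconductivity.HubbardSuperconductivity.Theorems.AnisotropyChord.InsertionEntropy
open Summit.HubbardSuperconductivity.HubbardSuperconductivity.Theorems.AnisotropyChord.Tower
open Summit.AtomisticToContinuum.BoseEinsteinCondensation.Theorems.BECStronglyRayleighSectorPerron
  (torusGraph_connected)

namespace Summit.HubbardSuperconductivity.HubbardSuperconductivity.Theorems.AnisotropyChord.Transfer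

variable {L : ℕ} [NeZero L]

/-- **At `Δ = 1` the transposition form vanishes on a Perron sector ground amplitude and `E(M) = −D/8`:**
`⟨a, A a⟩ = 0` and `lowestEnergyInSector H(1) M + D/8 = 0`.  Proof: `⟨a, A a⟩ = E(M) + D/8` (eigen-equation),
`E(M) + D/8 ≤ 0` by Rayleigh–Ritz with the uniform sector amplitude (killed by `A`), `⟨a, A a⟩ ≥ 0`. [folklore] -/
theorem perron_inner_fmOp_eq_zero_of_one {M : ℝ} {a : TensorIndex (TorusSite 2 L) 2 → ℝ}
    (ha : IsPerronSectorGroundAmplitude L 1 M a) :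
    ∑ σ, a σ * fmOp (torusGraph 2 L) a σ = 0 ∧
      lowestEnergyInSector 1 (xxzHamiltonian 1 (torusGraph 2 L) (-1) 1) M
        + (1/8 : ℝ) * ∑ x, ∑ y, (if (torusGraph 2 L).Adj x y then (1:ℝ) else 0) = 0 := by
  set e : ℝ := lowestEnergyInSector 1 (xxzHamiltonian 1 (torusGraph 2 L) (-1) 1) M
        + (1/8 : ℝ) * ∑ x, ∑ y, (if (torusGraph 2 L).Adj x y then (1:ℝ) else 0) with he
  -- `⟨a, A a⟩ = e`
  have h1 : ∑ σ, a σ * fmOp (torusGraph 2 L) a σ = e := by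
    have h := perron_energy_real ha
    rw [← he] at h
    rw [← h]
    refine Finset.sum_congr rfl fun σ _ => ?_
    ring
  -- the uniform sector amplitude as a test vector
  set n : ℝ := (Fintype.card (TorusSite 2 L) : ℝ) / 2 + M with hn
  set b : TensorIndex (TorusSite 2 L) 2 → ℝ := fun σ => if zerosCard σ = n then 1 else 0 with hb
  have hbsupp : ∀ σ, b σ ≠ 0 → zerosCard σ = n := by
    intro σ h
    by_contra hne
    exact h (by simp only [hb, hne, if_false])
  have hray := rayleigh_real (L := L) 1 M b hbsupp
  have hfm : fmOp (torusGraph 2 L) b = fun _ => 0 :=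
    fmOp_sectorFun (torusGraph 2 L) (fun r => if r = n then (1:ℝ) else 0)
  have hR : ∑ σ, b σ * (fmOp (torusGraph 2 L) b σ + (1 - 1) * (isingW (torusGraph 2 L) σ * b σ)) = 0 := by
    refine Finset.sum_eq_zero fun σ _ => ?_
    rw [hfm]
    ring
  rw [hR, ← he] at hray
  -- `a` has a support point, which lies in the sector, so `Σ b² > 0`
  obtain ⟨σ₀, hσ₀⟩ : ∃ σ, a σ ≠ 0 := by
    by_contra h
    push Not at h
    have hu := ha.unit
    simp [h] at hu
  have hbpos : 0 < ∑ σ, b σ ^ 2 := by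
    have hσ₀n : zerosCard σ₀ = n := perron_support ha σ₀ hσ₀
    have hb1 : b σ₀ = 1 := by simp only [hb, hσ₀n, if_true]
    calc (0 : ℝ) < b σ₀ ^ 2 := by rw [hb1]; norm_num
      _ ≤ ∑ σ, b σ ^ 2 := Finset.single_le_sum (fun σ _ => sq_nonneg (b σ)) (Finset.mem_univ σ₀)
  have he_le : e ≤ 0 := by
    by_contra hpos
    push Not at hpos
    have := mul_pos hpos hbpos
    linarith
  have he_ge : 0 ≤ e := h1 ▸ inner_fmOp_nonneg (torusGraph 2 L) a
  have he0 : e = 0 := le_antisymm he_le he_ge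
  exact ⟨h1.trans he0, he0⟩

/-- **A Perron sector ground amplitude of `H(1)` is constant on each particle-number sector** (the torus graph is
connected, and `⟨a, A a⟩ = 0` forces invariance under every edge transposition). [folklore] -/
theorem perron_const_of_one {M : ℝ} {a : TensorIndex (TorusSite 2 L) 2 → ℝ}
    (ha : IsPerronSectorGroundAmplitude L 1 M a) :
    ∀ σ σ' : TensorIndex (TorusSite 2 L) 2, zerosCard σ = zerosCard σ' → a σ = a σ' :=
  sectorFun_of_edgeSwapInvariant (torusGraph 2 L) (torusGraph_connected 2 L) a
    (swapInvariant_of_inner_fmOp_eq_zero (torusGraph 2 L) a (perron_inner_fmOp_eq_zero_of_one ha).1)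

/-- **REDUCTION: the exclusion Poincaré inequality on the sector gives the Temple-form sector gap at `Δ = 1`.**
If every real amplitude `ψ` supported on the configurations of the sector `Sᶻ_tot = M` with `Σ_σ ψ σ = 0` obeys
`t · Σ ψ² ≤ ⟨ψ, A ψ⟩` (`A = fmOp`, the exclusion generator `½ Σ_{edges}(1 − T_xy)`), then
`SectorGapAtLeast L 1 M t`.  Proof: for a unit real `φ` in the sector and the Perron amplitude `a` (uniform on the
sector by `perron_const_of_one`), `ψ = φ − ⟨a, φ⟩ a` has mean zero, `Σ ψ² = 1 − ⟨a, φ⟩²`, `⟨ψ, A ψ⟩ = ⟨φ, A φ⟩`, and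
`⟨φ, H(1) φ⟩ − E(M) = ⟨φ, A φ⟩` since `E(M) = −D/8`. [folklore] -/
theorem sectorGapAtLeast_one_of_exclusionGap (M t : ℝ)
    (hgap : ∀ ψ : TensorIndex (TorusSite 2 L) 2 → ℝ,
      (∀ σ, ψ σ ≠ 0 → zerosCard σ = (Fintype.card (TorusSite 2 L) : ℝ) / 2 + M) →
      ∑ σ, ψ σ = 0 →
      t * ∑ σ, ψ σ ^ 2 ≤ ∑ σ, ψ σ * fmOp (torusGraph 2 L) ψ σ) :
    SectorGapAtLeast L 1 M t := by
  intro a φ ha hφ hunit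
  set n : ℝ := (Fintype.card (TorusSite 2 L) : ℝ) / 2 + M with hn
  have hasupp : ∀ σ, a σ ≠ 0 → zerosCard σ = n := perron_support ha
  have hφsupp : ∀ σ, φ σ ≠ 0 → zerosCard σ = n := fun σ h => by
    have h' := zerosCard_of_mem_spinZSector hφ σ h
    unfold zerosCard
    rw [h']
  obtain ⟨h0, hE⟩ := perron_inner_fmOp_eq_zero_of_one ha
  have hconst := perron_const_of_one ha
  -- the value of `a` on the sector
  obtain ⟨σ₀, hσ₀⟩ : ∃ σ, a σ ≠ 0 := by
    by_contra h
    push Not at h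
    have hu := ha.unit
    simp [h] at hu
  set a₀ : ℝ := a σ₀ with ha₀
  have hσ₀n : zerosCard σ₀ = n := hasupp σ₀ hσ₀
  -- `a = a₀` on the sector, `a = 0` off the sector; hence `a·φ = a₀·φ` and `a·a = a₀·a` pointwise
  have haφ : ∀ σ, a σ * φ σ = a₀ * φ σ := by
    intro σ
    by_cases hσ : zerosCard σ = n
    · rw [hconst σ σ₀ (hσ.trans hσ₀n.symm)]
    · have h1 : φ σ = 0 := by by_contra h'; exact hσ (hφsupp σ h')
      rw [h1, mul_zero, mul_zero]
  have haa : ∀ σ, a σ * a σ = a₀ * a σ := by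
    intro σ
    by_cases hσ : zerosCard σ = n
    · rw [hconst σ σ₀ (hσ.trans hσ₀n.symm)]
    · have h1 : a σ = 0 := by by_contra h'; exact hσ (hasupp σ h')
      rw [h1, mul_zero, mul_zero]
  set c : ℝ := ∑ σ, a σ * φ σ with hc
  have hc' : c = a₀ * ∑ σ, φ σ := by
    rw [hc, Finset.mul_sum]
    exact Finset.sum_congr rfl fun σ _ => haφ σ
  have hsuma : a₀ * ∑ σ, a σ = 1 := by
    rw [← ha.unit, Finset.mul_sum]
    refine Finset.sum_congr rfl fun σ _ => ?_
    rw [sq, haa σ]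
  -- the mean-zero test amplitude
  set ψ : TensorIndex (TorusSite 2 L) 2 → ℝ := fun σ => φ σ - c * a σ with hψ
  have hψsupp : ∀ σ, ψ σ ≠ 0 → zerosCard σ = n := by
    intro σ h
    by_contra hne
    have h1 : φ σ = 0 := by by_contra h'; exact hne (hφsupp σ h')
    have h2 : a σ = 0 := by by_contra h'; exact hne (hasupp σ h')
    exact h (by simp only [hψ, h1, h2, mul_zero, sub_zero])
  have hψmean : ∑ σ, ψ σ = 0 := by
    simp only [hψ, Finset.sum_sub_distrib, ← Finset.mul_sum]
    rw [hc', mul_comm a₀, mul_assoc, hsuma, mul_one, sub_self]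
  have hψnorm : ∑ σ, ψ σ ^ 2 = 1 - c ^ 2 := by
    have hexp : ∀ σ, ψ σ ^ 2 = φ σ ^ 2 - 2 * c * (a σ * φ σ) + c ^ 2 * a σ ^ 2 := by
      intro σ; simp only [hψ]; ring
    simp only [hexp, Finset.sum_add_distrib, Finset.sum_sub_distrib, ← Finset.mul_sum]
    rw [hunit, ha.unit, ← hc]
    ring
  -- the transposition form does not see the constant-on-sector shift
  have hdiff : ∀ (x y : TorusSite 2 L) (σ : TensorIndex (TorusSite 2 L) 2),
      ψ σ - ψ (σ ∘ ⇑(Equiv.swap x y)) = φ σ - φ (σ ∘ ⇑(Equiv.swap x y)) := by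
    intro x y σ
    simp only [hψ]
    rw [hconst (σ ∘ ⇑(Equiv.swap x y)) σ (zerosCard_comp_perm σ _)]
    ring
  have hform : ∑ σ, ψ σ * fmOp (torusGraph 2 L) ψ σ = ∑ σ, φ σ * fmOp (torusGraph 2 L) φ σ := by
    rw [inner_fmOp_eq, inner_fmOp_eq]
    simp only [hdiff]
  -- the energy side: `⟨φ, H(1)φ⟩ − E(M) = ⟨φ, Aφ⟩`
  have henergy : energyQ L 1 φ - sectorE L 1 M = ∑ σ, φ σ * fmOp (torusGraph 2 L) φ σ := by
    rw [energyQ_eq_real]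
    unfold sectorE ham
    have hq : ∑ σ, φ σ * (fmOp (torusGraph 2 L) φ σ + (1 - 1) * (isingW (torusGraph 2 L) σ * φ σ))
        = ∑ σ, φ σ * fmOp (torusGraph 2 L) φ σ :=
      Finset.sum_congr rfl fun σ _ => by ring
    rw [hq, hunit]
    linarith [hE]
  have key := hgap ψ hψsupp hψmean
  rw [hψnorm, hform] at key
  rw [henergy]
  exact key

end Summit.HubbardSuperconductivity.HubbardSuperconductivity.Theorems.AnisotropyChord.Transfer

end
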